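import Mathlib
import Literature.Combinatorics.Games.ParityGame
import Literature.Combinatorics.Games.UniversalTrees

/-!
# Progress-measure lifting for parity games, unrolled: definitions
(route PneNP/PositionalGames, support item stmt-PneNP-1298 `ParityMonotoneQuasipolyUpper`)

Objects used by the proof of the quasi-polynomial monotone upper bound for the winning-region
function `ParityGame.winFn` of a parity template — the lifting algorithm for progress measures
(Jurdziński 2000; succinct / universal-tree version Jurdziński–Lazić 2017, Czerwiński et al. 2019
§2) run over the depth-`H` level of the universal tree `OrderedTree.univ` and unrolled into a
straight-line program over `{∧₂, ∨₂, 0, 1}`: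

* `Val U` — values of a PARTIAL progress measure: labels `U : Finset (List ℕ)` compared
  lexicographically, a new bottom `⊥`, and `⊤` ("no measure");
* `trunc i`, `Prog i s` — truncation to the first `i` components and the progress condition of an
  edge whose source sees `i` components (strict iff `s`), as a `Bool`;
* `lift i s m` — the least value progressive against a successor of value `m`; `theta i s t` — the
  threshold transform, `m < theta i s t ↔ lift i s m < t` (proved in `…Order.lean`);
* `tl H r` — the number of components seen by vertex priority `r` for labels of length `H`;
* `step o p H x μ`, `iter` — one round of SIMULTANEOUS lifting on the game encoded by the bits `x`
  (edge `u → w` present iff `x (u, w) = o u`, i.e. `ParityGame.edgeOfBits`), and its iterates from `⊥`;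
* `Wire`, `roundFn`, `initFn`, `outFn` — the same round on threshold bits `[μ u < t]`: the Boolean
  maps realised gate by gate by the monotone program (`…Circuit.lean`);
* `prefixTree S` (the ordered tree spanned by a set of sequences), `auxGame`, `auxStrat` (the game
  graph on which Jurdziński's measure is taken in the completeness proof, `…Complete.lean`);
* `compress p` — priority compression to values `< 2n` with the same order and parities.

Design: all definitions are noncomputable/classical — only the existence of the gate list matters.
Facts about them: `…Order.lean` (order core, stabilisation), `…Sound.lean`, `…Embedding.lean`,
`…Complete.lean`, `…Circuit.lean`, and the deciding file `PositionalGamesParityMonotoneQuasipolyUpper.lean`.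
-/

namespace Summit.PneNP.PneNP.Theorems.ParityLifting

set_option linter.dupNamespace false -- `Summit.PneNP.PneNP.…`: summit = sub-problem (D-0017)

open Literature.Combinatorics.Games

/-! ### Values -/

/-- The values of a partial progress measure over the label set `U`: `WithTop (WithBot U)` —
labels compared lexicographically, a bottom `⊥` below and a top `⊤` above all of them. -/
abbrev Val (U : Finset (List ℕ)) : Type := WithTop (WithBot {l : List ℕ // l ∈ U})

variable {U : Finset (List ℕ)}

/-- Truncation of a value to its first `i` components (`⊤ ↦ ⊤`, `⊥ ↦ ⊥`). -/
def trunc (i : ℕ) : Val U → WithTop (WithBot (List ℕ)) :=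
  WithTop.map (WithBot.map fun l => l.1.take i)

/-- The progress condition for an edge whose source carries `m'` and sees `i` components and whose
target carries `m`: `m|ᵢ ≤ m'|ᵢ`, strictly if `s` (odd priority). -/
def Prog (i : ℕ) (s : Bool) (m' m : Val U) : Bool :=
  if s = true then decide (trunc i m < trunc i m') else decide (trunc i m ≤ trunc i m')

open Classical in
/-- `lift i s m`: the least value `m'` with `Prog i s m' m` (`⊤` if there is none). -/
noncomputable def lift (i : ℕ) (s : Bool) (m : Val U) : Val U :=
  (Finset.univ.filter fun m' => Prog i s m' m).inf id

open Classical in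
/-- `theta i s t`: the least value `m` with `t ≤ lift i s m`; then `m < theta i s t ↔ lift i s m < t`. -/
noncomputable def theta (i : ℕ) (s : Bool) (t : Val U) : Val U :=
  (Finset.univ.filter fun m => t ≤ lift i s m).inf id

/-- The number of label components seen by a vertex of priority `r` when labels have length `H`
(component `j` stands for the odd priority `2H - 3 - 2j`; cf. `ParityGame.truncation` with
`d = 2H` and edge priority `r + 2`). -/
def tl (H r : ℕ) : ℕ := (2 * H - 1 - r) / 2

/-! ### One round of lifting -/

variable {V : Type*} [Fintype V]

open Classical in
/-- One round of simultaneous lifting on the game with owners `o`, priorities `p`, labels of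
length `H`, encoded by the bits `x` (edge `u → w` present iff `x (u, w) = o u`): an Even vertex
takes the least, an Odd vertex the largest lifted successor value. -/
noncomputable def step (o : V → Bool) (p : V → ℕ) (H : ℕ) (x : V × V → Bool) (μ : V → Val U)
    (u : V) : Val U :=
  if o u = true then
    (Finset.univ.filter fun w => x (u, w) = true).inf
      fun w => lift (tl H (p u)) (decide (Odd (p u))) (μ w)
  else
    (Finset.univ.filter fun w => x (u, w) = false).sup
      fun w => lift (tl H (p u)) (decide (Odd (p u))) (μ w)

/-- The `k`-th iterate of lifting from the bottom measure. -/
noncomputable def iter (o : V → Bool) (p : V → ℕ) (H : ℕ) (x : V × V → Bool) (k : ℕ) :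
    V → Val U :=
  (step o p H x)^[k] ⊥

/-! ### The same round on threshold bits -/

/-- The wires of the lifting program: the input bits `Sum.inl (u, w)` and one wire
`Sum.inr (u, t)` per vertex `u` and threshold `t`, carrying `[μ u < t]`. -/
abbrev Wire (V : Type*) (U : Finset (List ℕ)) : Type _ := (V × V) ⊕ (V × Val U)

open Classical in
/-- One round of lifting on threshold bits: at an Even vertex `⋁_w x(u,w) ∧ [μ w < θ_u t]`, at an
Odd vertex `⋀_w x(u,w) ∨ [μ w < θ_u t]`; input bits are copied. -/
noncomputable def roundFn (o : V → Bool) (p : V → ℕ) (H : ℕ) (y : Wire V U → Bool) :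
    Wire V U → Bool
  | .inl e => y (.inl e)
  | .inr (u, t) =>
    if o u = true then
      decide (∃ w, y (.inl (u, w)) = true ∧
        y (.inr (w, theta (tl H (p u)) (decide (Odd (p u))) t)) = true)
    else
      decide (∀ w, y (.inl (u, w)) = true ∨
        y (.inr (w, theta (tl H (p u)) (decide (Odd (p u))) t)) = true)

open Classical in
/-- The initial wires: the input bits and the threshold bits `[⊥ < t]` of the bottom measure. -/
noncomputable def initFn (x : V × V → Bool) : Wire V U → Bool
  | .inl e => x e
  | .inr (_, t) => decide (⊥ < t)

open Classical in
/-- The output: `NoEvenDeadEnd ∧ (SomeOddDeadEnd ∨ [μ v < ⊤])`. -/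
noncomputable def outFn (o : V → Bool) (v : V) (y : Wire V U → Bool) : Bool :=
  decide ((∀ u, o u = true → ∃ w, y (.inl (u, w)) = true) ∧
    ((∃ u, o u = false ∧ ∀ w, y (.inl (u, w)) = true) ∨ y (.inr (v, ⊤)) = true))

/-! ### Objects of the completeness proof -/

open Classical in
/-- The ordered tree spanned by a finite set of sequences: the root and all prefixes of members. -/
noncomputable def prefixTree (S : Finset (List ℕ)) : OrderedTree where
  nodes := insert [] (S.biUnion fun l => (Finset.range (l.length + 1)).image fun i => l.take i)
  nil_mem := Finset.mem_insert_self _ _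
  mem_of_isPrefix := by
    intro a b hb hab
    rw [Finset.mem_insert, Finset.mem_biUnion] at hb ⊢
    rcases hb with rfl | ⟨l, hl, hb⟩
    · exact Or.inl (List.prefix_nil.1 hab)
    · refine Or.inr ⟨l, hl, ?_⟩
      rw [Finset.mem_image] at hb ⊢
      obtain ⟨i, hi, rfl⟩ := hb
      have hlen := hab.length_le
      rw [List.length_take] at hlen
      rw [Finset.mem_range] at hi
      refine ⟨a.length, Finset.mem_range.2 (by omega), ?_⟩
      rw [List.prefix_iff_eq_take] at hab
      rw [le_min_iff] at hlen
      conv_rhs => rw [hab]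
      rw [List.take_take, min_eq_left hlen.1]

open Classical in
/-- The auxiliary game graph on which Jurdziński's measure is taken (completeness proof): inside
the region `W` an Even vertex keeps only its strategy edge `u → σ u` and an Odd vertex all its
present edges, with edge priority `p u + 2`; outside `W` every vertex gets a self-loop of
priority `2`. -/
noncomputable def auxGame (o : V → Bool) (p : V → ℕ) (x : V × V → Bool) (W : Set V) (σ : V → V)
    (hx : ∀ u, ∃ w, x (u, w) = o u) : Literature.Combinatorics.Games.ParityGame V where
  succ u := if u ∈ W then
      (if o u = true then {σ u} else Finset.univ.filter fun w => x (u, w) = false)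
    else {u}
  succ_nonempty u := by
    by_cases hu : u ∈ W
    · by_cases ho : o u = true
      · simp [hu, ho]
      · obtain ⟨w, hw⟩ := hx u
        rw [Bool.not_eq_true] at ho
        refine ⟨w, ?_⟩
        simp only [hu, ho, if_true]
        exact Finset.mem_filter.2 ⟨Finset.mem_univ _, by rw [hw, ho]⟩
    · simp [hu]
  prio u _ := if u ∈ W then p u + 2 else 2
  prio_pos := by
    intro u w _
    split_ifs <;> omega
  isEven := o

open Classical in
/-- Even's strategy in the auxiliary game: `σ` inside `W`, the self-loop outside. -/
noncomputable def auxStrat (W : Set V) (σ : V → V) : V → V := fun u => if u ∈ W then σ u else u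

/-! ### Priority compression -/

/-- **Compressed priorities**: `2 · #{values of p below p u} + (p u mod 2)` — same relative order
on the values of `p`, same parities, and all below `2n`. -/
noncomputable def compress {n : ℕ} (p : Fin n → ℕ) : Fin n → ℕ :=
  fun u => 2 * ((Finset.univ.image p).filter fun q => q < p u).card + p u % 2

end Summit.PneNP.PneNP.Theorems.ParityLifting
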